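import Mathlib
import HarnessLib
import Summits.HubbardSuperconductivity.HubbardSuperconductivity.Theorems.KLProgrammeKLRegimeSplitTwoLegSizesMSFitSizes
import Summits.HubbardSuperconductivity.HubbardSuperconductivity.Theorems.KLProgrammeKLRegimeSplitTwoLegSizesMSFitDom

/-!
# Route `KLProgramme`, crux K3 — ENGINE child (stmt-…-19918 → gen-6 engine child, `stub_twoLeg_step` / `stub_twoLeg_scale0`,
# clause (E3a-MS)): THE SLOT FITS AT THE GRADED LEVEL — closed-form slot size ≤ `Q.CE`-keyed budget, given ONE inequality on `Q.CE·G.S₁·Gfr_j`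

Cell `gate-hubbard-kl`, seat hubbard-kl-k3c3-p3 (g4) «implicit-function / monotonicity route for μ(n)»; MS-A34 (#42), plan g14 l.2058 / (R17)
(«the ONE inequality the engine's Q-package must satisfy»).  Graded variables: `x = 4^m` (slot), `y = 4^{n₀}` (scale, `n₀ ≥ 1`), `4y ≤ x`
(`m > n₀`), `0 < U ≤ 1`; slot grading `η ≤ 4Ḡ·U²/x²`, `λ ≤ 2x`, `e₀ ≤ 1923·Gfr₁·U²/(xy)` (Jackson order one at `d = 4^{n₀}`), frame sizes
`A₃ ≤ (4/3)Gfr₃U²y + λ₃Gfr₁U²y + (16/3)Gfr₃U²x`, `A₄ ≤ (16/15)Gfr₄U²y² + λ₄Gfr₁U²y² + (64/15)Gfr₄U²x²` (k3c3-p1's `msA3L/msA4L` with the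
low-part totals `Λ₃ ≤ λ₃Gfr₁U²4^{n₀}`, `Λ₄ ≤ λ₄Gfr₁U²16^{n₀}` of the mixed Jackson–Bernstein bound, MS-A34-ter),
increment-symbol profile `σ1 l ≤ μ_l·U²·(y/4)^{l−2}`, response profile `εm l ≤ ν_l·U²/y·pieceSize`, budget
`CE·(S1 + S1'U)·U²/y · (Gfr_j·uPow_j·x^{j−2})` (= `msBarQ … n₀ · pieceSize R U m j`).  For each order `j ≤ 4`: the `extSize` closed form of
`…MSFitSizesOsc` is ≤ the budget provided `REQ_j(X, μ, ν, Ḡ, Gfr) ≤ CE·S1·Gfr_j` (`ms_slot_fit_*`; `REQ_j` printed in the statement — the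
numerical content of MS-A34 §3 / STATUS 07:11Z, every term shape-checked by the generator).  Method: monotone substitution (`gcongr`), clearing
`x²y³` (`field_simp; ring`), per-monomial domination `Uᵃxᴾyᵠ ≤ w·U⁴xʲy²` (`fit_dom_hi/lo`, `U ≤ 1`, `y ≥ 4`, `x ≥ 4y`), summation.
THIS FILE: order 0, chunk lemmas 1/1 (cleared identities + dominations).  Pure real inequalities; everything PROVED; no definitions, no named facts. [folklore]
-/


noncomputable section

namespace Summit.HubbardSuperconductivity.HubbardSuperconductivity.Theorems.KLRegimeSplit

set_option linter.dupNamespace false -- summit = problem name (single-conjunct summit), D-0017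

open Real

set_option maxHeartbeats 800000 in
set_option maxRecDepth 8000 in
/-- Order-0 slot fit, chunk 1/1: the cleared identity (substituted terms)·x²y³ = monomials. [folklore] -/
theorem ms_slot_key_zero_1 {X U x y G0 : ℝ} {μ ν : ℕ → ℝ} (hxne : x ≠ 0) (hyne : y ≠ 0) :
    (((ν 0 * U ^ 2 / y * (G0 * U / x ^ 2))) + ((4 * μ 1 * U ^ 2 / y) * (7 * (8 * G0 * U / x ^ 2))) + (2 * X * (2 * (ν 0 * U ^ 2 / y * (G0 * U / x ^ 2)))) + (2 * X * (14 * (4 * μ 1 * U ^ 2 / y) * (8 * G0 * U / x ^ 2)))) * (x ^ 2 * y ^ 3) =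
      (1 * (G0 * ν 0) * (U ^ 3 * (x ^ 0 * y ^ 2))) +
      (224 * (G0 * μ 1) * (U ^ 3 * (x ^ 0 * y ^ 2))) +
      (4 * (X * G0 * ν 0) * (U ^ 3 * (x ^ 0 * y ^ 2))) +
      (896 * (X * G0 * μ 1) * (U ^ 3 * (x ^ 0 * y ^ 2))) := by
  have split : (((ν 0 * U ^ 2 / y * (G0 * U / x ^ 2))) + ((4 * μ 1 * U ^ 2 / y) * (7 * (8 * G0 * U / x ^ 2))) + (2 * X * (2 * (ν 0 * U ^ 2 / y * (G0 * U / x ^ 2)))) + (2 * X * (14 * (4 * μ 1 * U ^ 2 / y) * (8 * G0 * U / x ^ 2)))) * (x ^ 2 * y ^ 3) =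
      ((ν 0 * U ^ 2 / y * (G0 * U / x ^ 2))) * (x ^ 2 * y ^ 3) +
      ((4 * μ 1 * U ^ 2 / y) * (7 * (8 * G0 * U / x ^ 2))) * (x ^ 2 * y ^ 3) +
      (2 * X * (2 * (ν 0 * U ^ 2 / y * (G0 * U / x ^ 2)))) * (x ^ 2 * y ^ 3) +
      (2 * X * (14 * (4 * μ 1 * U ^ 2 / y) * (8 * G0 * U / x ^ 2))) * (x ^ 2 * y ^ 3) := by
    ring
  have k1 : ((ν 0 * U ^ 2 / y * (G0 * U / x ^ 2))) * (x ^ 2 * y ^ 3) =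
      1 * (G0 * ν 0) * (U ^ 3 * (x ^ 0 * y ^ 2)) := by
    field_simp
    try ring
  have k2 : ((4 * μ 1 * U ^ 2 / y) * (7 * (8 * G0 * U / x ^ 2))) * (x ^ 2 * y ^ 3) =
      224 * (G0 * μ 1) * (U ^ 3 * (x ^ 0 * y ^ 2)) := by
    field_simp
    try ring
  have k3 : (2 * X * (2 * (ν 0 * U ^ 2 / y * (G0 * U / x ^ 2)))) * (x ^ 2 * y ^ 3) =
      4 * (X * G0 * ν 0) * (U ^ 3 * (x ^ 0 * y ^ 2)) := by
    field_simp
    try ring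
  have k4 : (2 * X * (14 * (4 * μ 1 * U ^ 2 / y) * (8 * G0 * U / x ^ 2))) * (x ^ 2 * y ^ 3) =
      896 * (X * G0 * μ 1) * (U ^ 3 * (x ^ 0 * y ^ 2)) := by
    field_simp
    try ring
  rw [split, k1, k2, k3, k4]

set_option maxHeartbeats 800000 in
set_option maxRecDepth 8000 in
/-- Order-0 slot fit, chunk 1/1: monomial domination on `0 < U ≤ 1`, `4 ≤ y`, `4y ≤ x`. [folklore] -/
theorem ms_slot_dom_zero_1 {X U x y G0 : ℝ} {μ ν : ℕ → ℝ}
    (hX : 0 ≤ X) (hU : 0 < U) (hU1 : U ≤ 1) (hy : 4 ≤ y) (hyx : 4 * y ≤ x) (hG0 : 0 ≤ G0) (hμ : ∀ i, 0 ≤ μ i) (hν : ∀ i, 0 ≤ ν i) :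
    1 * (G0 * ν 0) * (U ^ 3 * (x ^ 0 * y ^ 2)) + 224 * (G0 * μ 1) * (U ^ 3 * (x ^ 0 * y ^ 2)) + 4 * (X * G0 * ν 0) * (U ^ 3 * (x ^ 0 * y ^ 2)) + 896 * (X * G0 * μ 1) * (U ^ 3 * (x ^ 0 * y ^ 2)) ≤
      (1 * (G0 * ν 0) + 224 * (G0 * μ 1) + 4 * (X * G0 * ν 0) + 896 * (X * G0 * μ 1)) * (U ^ 3 * (x ^ 0 * y ^ 2)) := by
  have hx0 : 0 < x := by linarith
  have hy0 : 0 < y := by linarith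
  have := hμ 0
  have := hμ 1
  have := hμ 2
  have := hμ 3
  have := hμ 4
  have := hμ 5
  have := hν 0
  have := hν 1
  have := hν 2
  have := hν 3
  have := hν 4
  have t1 : 1 * (G0 * ν 0) * (U ^ 3 * (x ^ 0 * y ^ 2)) ≤ 1 * (G0 * ν 0) * (U ^ 3 * (((1 / 4) ^ 0 * (1 / 16) ^ 0) * (x ^ 0 * y ^ 2))) :=
    mul_le_mul_of_nonneg_left (mul_le_mul (pow_le_pow_of_le_one hU.le hU1 (by norm_num : 3 ≤ 3)) (fit_dom_hi hy hyx (by norm_num : (2:ℕ) = 0 + 2) (by norm_num : (0:ℕ) = 0 + 0 + 0)) (by positivity) (by positivity)) (by positivity)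
  have t2 : 224 * (G0 * μ 1) * (U ^ 3 * (x ^ 0 * y ^ 2)) ≤ 224 * (G0 * μ 1) * (U ^ 3 * (((1 / 4) ^ 0 * (1 / 16) ^ 0) * (x ^ 0 * y ^ 2))) :=
    mul_le_mul_of_nonneg_left (mul_le_mul (pow_le_pow_of_le_one hU.le hU1 (by norm_num : 3 ≤ 3)) (fit_dom_hi hy hyx (by norm_num : (2:ℕ) = 0 + 2) (by norm_num : (0:ℕ) = 0 + 0 + 0)) (by positivity) (by positivity)) (by positivity)
  have t3 : 4 * (X * G0 * ν 0) * (U ^ 3 * (x ^ 0 * y ^ 2)) ≤ 4 * (X * G0 * ν 0) * (U ^ 3 * (((1 / 4) ^ 0 * (1 / 16) ^ 0) * (x ^ 0 * y ^ 2))) :=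
    mul_le_mul_of_nonneg_left (mul_le_mul (pow_le_pow_of_le_one hU.le hU1 (by norm_num : 3 ≤ 3)) (fit_dom_hi hy hyx (by norm_num : (2:ℕ) = 0 + 2) (by norm_num : (0:ℕ) = 0 + 0 + 0)) (by positivity) (by positivity)) (by positivity)
  have t4 : 896 * (X * G0 * μ 1) * (U ^ 3 * (x ^ 0 * y ^ 2)) ≤ 896 * (X * G0 * μ 1) * (U ^ 3 * (((1 / 4) ^ 0 * (1 / 16) ^ 0) * (x ^ 0 * y ^ 2))) :=
    mul_le_mul_of_nonneg_left (mul_le_mul (pow_le_pow_of_le_one hU.le hU1 (by norm_num : 3 ≤ 3)) (fit_dom_hi hy hyx (by norm_num : (2:ℕ) = 0 + 2) (by norm_num : (0:ℕ) = 0 + 0 + 0)) (by positivity) (by positivity)) (by positivity)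
  have s1 : 1 * (G0 * ν 0) * (U ^ 3 * (x ^ 0 * y ^ 2)) + 224 * (G0 * μ 1) * (U ^ 3 * (x ^ 0 * y ^ 2)) + 4 * (X * G0 * ν 0) * (U ^ 3 * (x ^ 0 * y ^ 2)) + 896 * (X * G0 * μ 1) * (U ^ 3 * (x ^ 0 * y ^ 2)) ≤
      1 * (G0 * ν 0) * (U ^ 3 * (((1 / 4) ^ 0 * (1 / 16) ^ 0) * (x ^ 0 * y ^ 2))) + 224 * (G0 * μ 1) * (U ^ 3 * (((1 / 4) ^ 0 * (1 / 16) ^ 0) * (x ^ 0 * y ^ 2))) +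
      4 * (X * G0 * ν 0) * (U ^ 3 * (((1 / 4) ^ 0 * (1 / 16) ^ 0) * (x ^ 0 * y ^ 2))) + 896 * (X * G0 * μ 1) * (U ^ 3 * (((1 / 4) ^ 0 * (1 / 16) ^ 0) * (x ^ 0 * y ^ 2))) := by
    linarith only [t1, t2, t3, t4]
  have s2 : 1 * (G0 * ν 0) * (U ^ 3 * (((1 / 4) ^ 0 * (1 / 16) ^ 0) * (x ^ 0 * y ^ 2))) + 224 * (G0 * μ 1) * (U ^ 3 * (((1 / 4) ^ 0 * (1 / 16) ^ 0) * (x ^ 0 * y ^ 2))) +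
      4 * (X * G0 * ν 0) * (U ^ 3 * (((1 / 4) ^ 0 * (1 / 16) ^ 0) * (x ^ 0 * y ^ 2))) + 896 * (X * G0 * μ 1) * (U ^ 3 * (((1 / 4) ^ 0 * (1 / 16) ^ 0) * (x ^ 0 * y ^ 2))) =
      (1 * (G0 * ν 0) + 224 * (G0 * μ 1) + 4 * (X * G0 * ν 0) + 896 * (X * G0 * μ 1)) * (U ^ 3 * (x ^ 0 * y ^ 2)) := by
    ring
  linarith only [s1, s2]

end Summit.HubbardSuperconductivity.HubbardSuperconductivity.Theorems.KLRegimeSplit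

end
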